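import Summits.AtomisticToContinuum.Crystallization.Theorems.OverbindingBudgetPeriodicPricingStatements

/-!
# OverbindingBudget · generation 23 · node «PeriodicPricing» — part 2/3: the tight periodisation («wrap») and its bookkeeping

Helper file for the crux `OverbindingBudget.RobustDefectLimitWindows` (stmt-AtomisticToContinuum-31280); line v7 untouched.

Given a texture `Y`, a cube `Q_ℓ(c) = {z | c_i ≤ z_i < c_i + ℓ}` and the TRIMMED PATCH `F' = Y ∩ {c_i ≤ z_i < c_i + ℓ − 1}` (the patch minus
the three top slabs of thickness `1`), the TIGHT PERIODISATION is the lattice orbit `wrap ℓ F' = F' + ℓℤ³`.  This part proves, all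
elementary and 0-sorry:

* §W geometry — `wrap_periodic` (W is `ℓℤ³`-periodic), `wrap_inter_cube` (its period cell is `F'`), `wrap_far` (distinct copies are `> 1`
  apart, because of the trimmed slab), `wrap_sep` (W is `min(δ,1)`-separated), `wrap_local` (W agrees with `Y` on the `2`-ball about every
  point at depth `≥ 2` below the seams), `wrap_cover` (covering radius `< 5` from covering radius `< 9/10` of `Y`), `wrap_thin` (thin cores
  within `3D+8` from thin cores within `D` of `Y`, by locality + lattice covariance of the exact tests), `wrap_viol` (margin-`t` robust
  violators `(3L+11)`-dense from `L`-dense ones of `Y`, same mechanism);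
* §E energy — `wrap_tail_nonpos` / `wrap_site_le` (the site sum of `W` at a patch point is at most its row sum over `F'`: every cross-seam
  distance is `≥ 1` and `V_LJ ≤ 0` there), `row_lower` (a row of pair terms over a `δ`-separated set is `≥ −C_δ`), `pair_sum_trim_le`
  (`D(F') ≤ D(F) + 2 C_δ · #(F ∖ F')`), `card_rim_le` (`#(F ∖ F') ≤ 3 (2/δ+1)(2ℓ/δ+1)²`).

Part 3 assembles these into `PeriodicDefectPricing → TypeFreeLaw D`.
-/

namespace Summit.AtomisticToContinuum.Crystallization.Theorems.OverbindingBudgetPeriodicWrap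

open scoped BigOperators
open Literature.MathematicalPhysics.StatisticalMechanics (UniformlyDiscrete lennardJones lennardJones_nonpos lennardJones_zero)
open Summit.AtomisticToContinuum.Crystallization.Theorems.OverbindingBudgetViolatorDensityFloor (GT RT)
open Summit.AtomisticToContinuum.Crystallization.Theorems.OverbindingBudgetWallTensionLever (BarlowClose ThinCores)
open Summit.AtomisticToContinuum.Crystallization.Theorems.OverbindingBudgetCubeBookkeeping (stub_siteSumSplit)
open Summit.AtomisticToContinuum.Crystallization.Theorems.OverbindingBudgetCubeTails (card_slab_le sum_abs_lennardJones_le_dyadic)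
open Summit.AtomisticToContinuum.Crystallization.Theorems.OverbindingBudgetPeriodicPricingStatements

/-! ## §W  The wrapped texture and its geometry -/

/-- `IsTrim Y c ℓ F'`: `F'` is exactly the trimmed patch `Y ∩ {c_i ≤ z_i < c_i + ℓ − 1}`. -/
def IsTrim (Y : Set (EuclideanSpace ℝ (Fin 3))) (c : EuclideanSpace ℝ (Fin 3)) (ℓ : ℝ) (F' : Finset (EuclideanSpace ℝ (Fin 3))) : Prop :=
  ∀ w, w ∈ F' ↔ w ∈ Y ∧ ∀ i : Fin 3, c i ≤ w i ∧ w i < c i + (ℓ - 1)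

/-- the tight periodisation `wrap ℓ F' = F' + ℓℤ³` -/
def wrap (ℓ : ℝ) (F' : Finset (EuclideanSpace ℝ (Fin 3))) : Set (EuclideanSpace ℝ (Fin 3)) :=
  {w | ∃ y ∈ F', ∃ k : Fin 3 → ℤ, w = y + lvec ℓ k}

/-- patch points are in the wrap -/
theorem mem_wrap_of_mem {ℓ : ℝ} {F' : Finset (EuclideanSpace ℝ (Fin 3))} {y : EuclideanSpace ℝ (Fin 3)} (hy : y ∈ F') :
    y ∈ wrap ℓ F' :=
  ⟨y, hy, 0, by rw [lvec_zero, add_zero]⟩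

/-- **W1.** the wrap is `ℓℤ³`-periodic -/
theorem wrap_periodic (ℓ : ℝ) (F' : Finset (EuclideanSpace ℝ (Fin 3))) : Periodic ℓ (wrap ℓ F') := by
  rintro w ⟨y, hy, k, rfl⟩ k'
  exact ⟨y, hy, k + k', by rw [add_assoc, lvec_add]⟩

/-- an integer `n` with `|ℓ n| < ℓ` vanishes -/
theorem int_eq_zero_of_abs_mul_lt {ℓ : ℝ} (hℓ : 0 < ℓ) {n : ℤ} (h : |ℓ * (n : ℝ)| < ℓ) : n = 0 := by
  by_contra hn
  have h1 : (1 : ℝ) ≤ |(n : ℝ)| := by rw [← Int.cast_abs]; exact_mod_cast Int.one_le_abs hn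
  rw [abs_mul, abs_of_pos hℓ] at h
  nlinarith

/-- **W4.** distinct lattice copies of patch points are `> 1` apart (the trimmed slab is the seam) -/
theorem wrap_far {ℓ : ℝ} {Y : Set (EuclideanSpace ℝ (Fin 3))} {c : EuclideanSpace ℝ (Fin 3)} {F' : Finset (EuclideanSpace ℝ (Fin 3))}
    (hℓ : 0 ≤ ℓ) (hF : IsTrim Y c ℓ F') {y y' : EuclideanSpace ℝ (Fin 3)} (hy : y ∈ F') (hy' : y' ∈ F') {k : Fin 3 → ℤ} (hk : k ≠ 0) :
    1 < dist y (y' + lvec ℓ k) :=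
  dist_shift_gt hℓ (fun i => by
    have h1 := ((hF y).1 hy).2 i
    have h2 := ((hF y').1 hy').2 i
    rw [abs_sub_lt_iff]; constructor <;> linarith) hk

/-- **W3.** the period cell of the wrap is the trimmed patch -/
theorem wrap_inter_cube {ℓ : ℝ} {Y : Set (EuclideanSpace ℝ (Fin 3))} {c : EuclideanSpace ℝ (Fin 3)} {F' : Finset (EuclideanSpace ℝ (Fin 3))}
    (hℓ : 0 < ℓ) (hF : IsTrim Y c ℓ F') :
    wrap ℓ F' ∩ {z | ∀ i : Fin 3, c i ≤ z i ∧ z i < c i + ℓ} = ↑F' := by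
  ext w
  simp only [Set.mem_inter_iff, Set.mem_setOf_eq, Finset.mem_coe]
  constructor
  · rintro ⟨⟨y, hy, k, rfl⟩, hw⟩
    have hyc := ((hF y).1 hy).2
    have hk : k = 0 := by
      funext i
      show k i = 0
      apply int_eq_zero_of_abs_mul_lt hℓ
      have h1 := hyc i
      have h2 := hw i
      rw [add_lvec_apply] at h2
      rw [abs_lt]; constructor <;> linarith
    rw [hk, lvec_zero, add_zero]; exact hy
  · intro hw
    exact ⟨mem_wrap_of_mem hw, fun i => ⟨(((hF w).1 hw).2 i).1, by linarith [(((hF w).1 hw).2 i).2]⟩⟩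

/-- **W5.** the wrap is `min(δ,1)`-separated -/
theorem wrap_sep {ℓ δ : ℝ} {Y : Set (EuclideanSpace ℝ (Fin 3))} {c : EuclideanSpace ℝ (Fin 3)} {F' : Finset (EuclideanSpace ℝ (Fin 3))}
    (hℓ : 0 ≤ ℓ) (hF : IsTrim Y c ℓ F') (hsep : ∀ x ∈ Y, ∀ y ∈ Y, x ≠ y → δ ≤ dist x y) :
    ∀ x ∈ wrap ℓ F', ∀ w ∈ wrap ℓ F', x ≠ w → min δ 1 ≤ dist x w := by
  rintro x ⟨y₁, hy₁, k₁, rfl⟩ w ⟨y₂, hy₂, k₂, rfl⟩ hne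
  have hre : y₂ + lvec ℓ k₂ = (y₂ + lvec ℓ (k₂ - k₁)) + lvec ℓ k₁ := by rw [add_assoc, lvec_add, sub_add_cancel]
  rw [hre, dist_add_right]
  by_cases hk : k₂ - k₁ = 0
  · rw [hk, lvec_zero, add_zero]
    have hk' : k₂ = k₁ := sub_eq_zero.1 hk
    have hne' : y₁ ≠ y₂ := by rintro rfl; exact hne (by rw [hk'])
    exact (min_le_left _ _).trans (hsep y₁ ((hF y₁).1 hy₁).1 y₂ ((hF y₂).1 hy₂).1 hne')
  · exact (min_le_right _ _).trans (wrap_far hℓ hF hy₁ hy₂ hk).le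

/-- the wrap is uniformly discrete -/
theorem wrap_ud {ℓ δ : ℝ} {Y : Set (EuclideanSpace ℝ (Fin 3))} {c : EuclideanSpace ℝ (Fin 3)} {F' : Finset (EuclideanSpace ℝ (Fin 3))}
    (hℓ : 0 ≤ ℓ) (hδ : 0 < δ) (hF : IsTrim Y c ℓ F') (hsep : ∀ x ∈ Y, ∀ y ∈ Y, x ≠ y → δ ≤ dist x y) :
    UniformlyDiscrete (wrap ℓ F') :=
  ⟨min δ 1, lt_min hδ one_pos, wrap_sep hℓ hF hsep⟩

/-- **W6 (locality at depth).** At a point `y` whose coordinates lie in `[c_i + 2, c_i + ℓ − 4]` the wrap and `Y` agree on the closed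
`2`-ball. -/
theorem wrap_local {ℓ : ℝ} {Y : Set (EuclideanSpace ℝ (Fin 3))} {c : EuclideanSpace ℝ (Fin 3)} {F' : Finset (EuclideanSpace ℝ (Fin 3))}
    (hℓ : 0 ≤ ℓ) (hF : IsTrim Y c ℓ F') {y : EuclideanSpace ℝ (Fin 3)} (hy : ∀ i : Fin 3, c i + 2 ≤ y i ∧ y i ≤ c i + ℓ - 4) :
    ∀ w, dist y w ≤ 2 → (w ∈ wrap ℓ F' ↔ w ∈ Y) := by
  intro w hw
  constructor
  · rintro ⟨y', hy', k, rfl⟩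
    by_cases hk : k = 0
    · rw [hk, lvec_zero, add_zero]; exact ((hF y').1 hy').1
    · exfalso
      have h2 : 2 < dist y (y' + lvec ℓ k) := dist_shift_gt hℓ (fun i => by
        have h1 := ((hF y').1 hy').2 i
        have h3 := hy i
        rw [abs_sub_lt_iff]; constructor <;> linarith) hk
      linarith
  · intro hwY
    refine mem_wrap_of_mem ((hF w).2 ⟨hwY, fun i => ?_⟩)
    have h1 := coord_le_of_dist_le hw i
    have h3 := hy i
    constructor <;> linarith

/-- **W7.** covering radius `< 5` of the wrap (from covering radius `< 9/10` of `Y`; `ℓ ≥ 3`) -/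
theorem wrap_cover {ℓ : ℝ} {Y : Set (EuclideanSpace ℝ (Fin 3))} {c : EuclideanSpace ℝ (Fin 3)} {F' : Finset (EuclideanSpace ℝ (Fin 3))}
    (hℓ : 3 ≤ ℓ) (hF : IsTrim Y c ℓ F') (hsolid : ∀ z : EuclideanSpace ℝ (Fin 3), ∃ w ∈ Y, dist z w < 9 / 10) :
    ∀ z : EuclideanSpace ℝ (Fin 3), ∃ w ∈ wrap ℓ F', dist z w < 5 := by
  intro z
  obtain ⟨k, hk⟩ := exists_reduce (show (0 : ℝ) < ℓ by linarith) c z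
  obtain ⟨q', hq', hd⟩ := exists_clamp (lo := 1) (hi := 2) (by norm_num) (by linarith) c (z - lvec ℓ k) hk
  obtain ⟨w, hwY, hw⟩ := hsolid q'
  have hwF : w ∈ F' := (hF w).2 ⟨hwY, fun i => by
    have h1 := coord_le_of_dist_le hw.le i
    have h2 := hq' i
    constructor <;> linarith⟩
  refine ⟨w + lvec ℓ k, wrap_periodic ℓ F' w (mem_wrap_of_mem hwF) k, ?_⟩
  have hz : z = (z - lvec ℓ k) + lvec ℓ k := (sub_add_cancel z _).symm
  rw [hz, dist_add_right]
  have hmax : max (1 : ℝ) 2 = 2 := by norm_num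
  rw [hmax] at hd
  calc dist (z - lvec ℓ k) w ≤ dist (z - lvec ℓ k) q' + dist q' w := dist_triangle _ _ _
    _ < 2 * 2 + 9 / 10 := by linarith
    _ < 5 := by norm_num

/-- **W8.** thin cores of the wrap within `3D + 8` (from thin cores of `Y` within `D`; `ℓ ≥ 2D + 6`): the exact clean Barlow site near a
deep point is deep, so locality transfers its status to the wrap and lattice covariance moves it next to any point. -/
theorem wrap_thin {ℓ a D : ℝ} {Y : Set (EuclideanSpace ℝ (Fin 3))} {c : EuclideanSpace ℝ (Fin 3)} {F' : Finset (EuclideanSpace ℝ (Fin 3))}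
    (hD : 0 ≤ D) (hℓ : 2 * D + 6 ≤ ℓ) (ha : a ≤ 1) (hF : IsTrim Y c ℓ F') (hthin : ThinCores a D Y) :
    ThinCores a (3 * D + 8) (wrap ℓ F') := by
  intro z
  obtain ⟨k, hk⟩ := exists_reduce (show (0 : ℝ) < ℓ by linarith) c z
  obtain ⟨q', hq', hd⟩ := exists_clamp (lo := D + 2) (hi := D + 4) (by linarith) (by linarith) c (z - lvec ℓ k) hk
  obtain ⟨y, hyY, hG, hB, hdy⟩ := hthin q'
  have hdeep : ∀ i : Fin 3, c i + 2 ≤ y i ∧ y i ≤ c i + ℓ - 4 := fun i => by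
    have h1 := coord_le_of_dist_le hdy i
    have h2 := hq' i
    constructor <;> linarith
  have hyF : y ∈ F' := (hF y).2 ⟨hyY, fun i => by have := hdeep i; constructor <;> linarith⟩
  have hloc := local_symm (wrap_local (by linarith) hF hdeep)
  have hG' : GT a (wrap ℓ F') y := gt_congr_local ha hloc hG
  have hB' : BarlowClose a (wrap ℓ F') y := barlowClose_congr_local ha hloc hB
  obtain ⟨hG'', hB''⟩ := gt_barlow_shift (wrap_periodic ℓ F') k hG' hB'
  refine ⟨y + lvec ℓ k, wrap_periodic ℓ F' y (mem_wrap_of_mem hyF) k, hG'', hB'', ?_⟩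
  have hz : z = (z - lvec ℓ k) + lvec ℓ k := (sub_add_cancel z _).symm
  rw [hz, dist_add_right]
  have hmax : max (D + 2) (D + 4) = D + 4 := max_eq_right (by linarith)
  rw [hmax] at hd
  calc dist (z - lvec ℓ k) y ≤ dist (z - lvec ℓ k) q' + dist q' y := dist_triangle _ _ _
    _ ≤ 2 * (D + 4) + D := by linarith
    _ = 3 * D + 8 := by ring

/-- **W9.** margin-`t` robust violators of the wrap are `(3L + 11)`-dense (from `L`-dense ones of `Y`, `L ≥ 0`, `ℓ ≥ 2L + 8`,
`0 ≤ t ≤ 1/10`): the violator of `Y` near a deep solid point is deep, locality makes it a violator of the wrap, covariance moves it. -/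
theorem wrap_viol {ℓ a t L : ℝ} {Y : Set (EuclideanSpace ℝ (Fin 3))} {c : EuclideanSpace ℝ (Fin 3)} {F' : Finset (EuclideanSpace ℝ (Fin 3))}
    (hL : 0 ≤ L) (hℓ : 2 * L + 8 ≤ ℓ) (ha : a ≤ 1) (ht0 : 0 ≤ t) (ht : t ≤ 1 / 10) (hF : IsTrim Y c ℓ F')
    (hsolid : ∀ z : EuclideanSpace ℝ (Fin 3), ∃ w ∈ Y, dist z w < 9 / 10)
    (hviol : ∀ q ∈ Y, ∃ y ∈ Y, dist y q ≤ L ∧ ¬ RT a t Y y) :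
    ∀ q ∈ wrap ℓ F', ∃ y ∈ wrap ℓ F', dist y q ≤ 3 * L + 11 ∧ ¬ RT a t (wrap ℓ F') y := by
  rintro q ⟨y₀, hy₀, k, rfl⟩
  have hk := ((hF y₀).1 hy₀).2
  have hk' : ∀ i : Fin 3, c i ≤ y₀ i ∧ y₀ i < c i + ℓ := fun i => ⟨(hk i).1, by linarith [(hk i).2]⟩
  obtain ⟨q', hq', hd⟩ := exists_clamp (ℓ := ℓ) (lo := L + 3) (hi := L + 5) (by linarith) (by linarith) c y₀ hk'
  obtain ⟨w, hwY, hw⟩ := hsolid q'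
  obtain ⟨y, hyY, hyw, hn⟩ := hviol w hwY
  have hdeep : ∀ i : Fin 3, c i + 2 ≤ y i ∧ y i ≤ c i + ℓ - 4 := fun i => by
    have h1 := coord_le_of_dist_le hw.le i
    have h2 := coord_le_of_dist_le hyw i
    have h3 := hq' i
    constructor <;> linarith
  have hyF : y ∈ F' := (hF y).2 ⟨hyY, fun i => by have := hdeep i; constructor <;> linarith⟩
  have hloc := wrap_local (by linarith) hF hdeep
  refine ⟨y + lvec ℓ k, wrap_periodic ℓ F' y (mem_wrap_of_mem hyF) k, ?_, fun hr => hn ?_⟩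
  · rw [dist_add_right]
    have hmax : max (L + 3) (L + 5) = L + 5 := max_eq_right (by linarith)
    rw [hmax] at hd
    have h1 := dist_triangle y w y₀
    have h2 := dist_triangle w q' y₀
    rw [dist_comm w q'] at h2
    rw [dist_comm q' y₀] at h2
    linarith
  · exact rt_congr_local ha ht0 ht hloc (rt_unshift (wrap_periodic ℓ F') k hr)

/-! ## §E  Energy bookkeeping of the wrap -/

/-- **E2.** the cross-seam tail of the wrap's site sum at a patch point is `≤ 0` (all its distances are `≥ 1`, where `V_LJ ≤ 0`) -/
theorem wrap_tail_nonpos {ℓ : ℝ} {Y : Set (EuclideanSpace ℝ (Fin 3))} {c : EuclideanSpace ℝ (Fin 3)} {F' : Finset (EuclideanSpace ℝ (Fin 3))}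
    (hℓ : 0 ≤ ℓ) (hF : IsTrim Y c ℓ F') {x : EuclideanSpace ℝ (Fin 3)} (hx : x ∈ F') :
    ∑' w : ↥(wrap ℓ F' \ ↑F'), lennardJones (dist x (w : EuclideanSpace ℝ (Fin 3))) ≤ 0 := by
  refine tsum_nonpos fun w => lennardJones_nonpos ?_
  obtain ⟨⟨y', hy', k, hk⟩, hnot⟩ := w.2
  have hk0 : k ≠ 0 := by
    rintro rfl
    apply hnot
    rw [Finset.mem_coe, hk, lvec_zero, add_zero]; exact hy'
  rw [hk]; exact (wrap_far hℓ hF hx hy' hk0).le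

/-- **E1 + E2.** the wrap's site sum at a patch point is at most the row sum over the patch -/
theorem wrap_site_le {ℓ δ : ℝ} {Y : Set (EuclideanSpace ℝ (Fin 3))} {c : EuclideanSpace ℝ (Fin 3)} {F' : Finset (EuclideanSpace ℝ (Fin 3))}
    (hℓ : 0 ≤ ℓ) (hδ : 0 < δ) (hF : IsTrim Y c ℓ F') (hsep : ∀ x ∈ Y, ∀ y ∈ Y, x ≠ y → δ ≤ dist x y)
    {x : EuclideanSpace ℝ (Fin 3)} (hx : x ∈ F') :
    (∑' w : ↥(wrap ℓ F'), lennardJones (dist x (w : EuclideanSpace ℝ (Fin 3)))) ≤ ∑ w ∈ F', lennardJones (dist x w) := by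
  rw [stub_siteSumSplit (wrap ℓ F') (wrap_ud hℓ hδ hF hsep) F' (fun y hy => mem_wrap_of_mem hy) x]
  linarith [wrap_tail_nonpos hℓ hF hx]

/-- **Row bound.** over a `δ`-separated finite set containing `x`, the pair terms of `x` against any sub-family sum to `≥ −C_δ`,
`C_δ = 432 (δ⁻⁶+1) δ⁻³ δ⁻³` (the diagonal term is `V(0) = 0` by convention). -/
theorem row_lower {δ : ℝ} (hδ : 0 < δ) (F : Finset (EuclideanSpace ℝ (Fin 3)))
    (hsep : ∀ z ∈ F, ∀ w ∈ F, z ≠ w → δ ≤ dist z w) {x : EuclideanSpace ℝ (Fin 3)} (hx : x ∈ F)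
    (S : Finset (EuclideanSpace ℝ (Fin 3))) (hS : S ⊆ F) :
    -(432 * (δ⁻¹ ^ 6 + 1) * δ⁻¹ ^ 3 * δ⁻¹ ^ 3) ≤ ∑ w ∈ S, lennardJones (dist x w) := by
  classical
  have h1 : ∑ w ∈ S, lennardJones (dist x w) = ∑ w ∈ S.erase x, lennardJones (dist x w) := by
    by_cases hxS : x ∈ S
    · rw [← Finset.add_sum_erase S _ hxS, dist_self, lennardJones_zero, zero_add]
    · rw [Finset.erase_eq_self.mpr hxS]
  rw [h1]
  have h2 := sum_abs_lennardJones_le_dyadic (S.erase x) x hδ le_rfl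
    (fun z hz => hsep x hx z (hS (Finset.mem_of_mem_erase hz)) (Finset.ne_of_mem_erase hz).symm)
    (fun z hz w hw hne => hsep z (hS (Finset.mem_of_mem_erase hz)) w (hS (Finset.mem_of_mem_erase hw)) hne)
  have h3 := Finset.abs_sum_le_sum_abs (fun w => lennardJones (dist x w)) (S.erase x)
  rw [abs_le] at h3
  linarith [h3.1]

/-- **E3.** trimming a `δ`-separated patch raises its pair sum by at most `2 C_δ` per removed point:
`D(F.filter P) ≤ D(F) + 2 C_δ · #(F.filter ¬P)`. -/
theorem pair_sum_trim_le {δ : ℝ} (hδ : 0 < δ) (F : Finset (EuclideanSpace ℝ (Fin 3)))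
    (hsep : ∀ z ∈ F, ∀ w ∈ F, z ≠ w → δ ≤ dist z w) (P : EuclideanSpace ℝ (Fin 3) → Prop) [DecidablePred P] :
    ∑ x ∈ F.filter P, ∑ w ∈ F.filter P, lennardJones (dist x w)
      ≤ ∑ x ∈ F, ∑ w ∈ F, lennardJones (dist x w)
        + 2 * (432 * (δ⁻¹ ^ 6 + 1) * δ⁻¹ ^ 3 * δ⁻¹ ^ 3) * ((F.filter fun x => ¬ P x).card : ℝ) := by
  set C : ℝ := 432 * (δ⁻¹ ^ 6 + 1) * δ⁻¹ ^ 3 * δ⁻¹ ^ 3 with hC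
  have hsplit : ∀ g : EuclideanSpace ℝ (Fin 3) → ℝ,
      ∑ x ∈ F, g x = ∑ x ∈ F.filter P, g x + ∑ x ∈ F.filter (fun x => ¬ P x), g x :=
    fun g => (Finset.sum_filter_add_sum_filter_not F P g).symm
  have h1 : ∑ x ∈ F, ∑ w ∈ F, lennardJones (dist x w)
      = ∑ x ∈ F.filter P, (∑ w ∈ F.filter P, lennardJones (dist x w) + ∑ w ∈ F.filter (fun x => ¬ P x), lennardJones (dist x w))
        + ∑ x ∈ F.filter (fun x => ¬ P x), ∑ w ∈ F, lennardJones (dist x w) := by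
    rw [hsplit]
    congr 1
    exact Finset.sum_congr rfl (fun x _ => hsplit _)
  rw [h1, Finset.sum_add_distrib]
  have hR : ∑ x ∈ F.filter (fun x => ¬ P x), (-C) ≤ ∑ x ∈ F.filter (fun x => ¬ P x), ∑ w ∈ F, lennardJones (dist x w) :=
    Finset.sum_le_sum (fun x hx => row_lower hδ F hsep (Finset.mem_of_mem_filter x hx) F subset_rfl)
  have hX : ∑ w ∈ F.filter (fun x => ¬ P x), (-C)
      ≤ ∑ w ∈ F.filter (fun x => ¬ P x), ∑ x ∈ F.filter P, lennardJones (dist x w) :=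
    Finset.sum_le_sum (fun w hw => by
      have h := row_lower hδ F hsep (Finset.mem_of_mem_filter w hw) (F.filter P) (Finset.filter_subset _ _)
      refine h.trans (le_of_eq (Finset.sum_congr rfl fun x _ => by rw [dist_comm])))
  rw [Finset.sum_comm] at hX
  have hc : ∑ x ∈ F.filter (fun x => ¬ P x), (-C) = -(C * ((F.filter fun x => ¬ P x).card : ℝ)) := by
    rw [Finset.sum_const, nsmul_eq_mul]; ring
  rw [hc] at hR hX
  linarith

/-- **E7.** the rim `F ∖ F'` of a `δ`-separated patch of `Q_ℓ(c)` (points with some coordinate in the top slab of thickness `1`) has at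
most `3 (2/δ+1)(2ℓ/δ+1)²` points. -/
theorem card_rim_le {δ ℓ : ℝ} (hδ : 0 < δ) (hℓ : 0 ≤ ℓ) (c : EuclideanSpace ℝ (Fin 3)) (F R : Finset (EuclideanSpace ℝ (Fin 3)))
    (hcube : ∀ z ∈ F, ∀ i : Fin 3, c i ≤ z i ∧ z i < c i + ℓ) (hsep : ∀ z ∈ F, ∀ w ∈ F, z ≠ w → δ ≤ dist z w)
    (hR : ∀ z ∈ R, z ∈ F ∧ ∃ i : Fin 3, c i + (ℓ - 1) ≤ z i) :
    (R.card : ℝ) ≤ 3 * ((2 * 1 / δ + 1) * (2 * ℓ / δ + 1) ^ 2) := by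
  classical
  have hsub : R ⊆ Finset.univ.biUnion (fun i : Fin 3 => F.filter fun x => c i + (ℓ - 1) ≤ x i) := by
    intro x hx
    obtain ⟨hxF, i, hi⟩ := hR x hx
    exact Finset.mem_biUnion.mpr ⟨i, Finset.mem_univ _, Finset.mem_filter.mpr ⟨hxF, hi⟩⟩
  have hslab : ∀ i : Fin 3, ((F.filter fun x => c i + (ℓ - 1) ≤ x i).card : ℝ) ≤ (2 * 1 / δ + 1) * (2 * ℓ / δ + 1) ^ 2 :=
    fun i => card_slab_le _ c ℓ 1 (c i + (ℓ - 1)) i hδ hℓ zero_le_one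
      (fun z hz => hcube z (Finset.mem_of_mem_filter z hz))
      (fun z hz => ⟨(Finset.mem_filter.mp hz).2, by linarith [(hcube z (Finset.mem_of_mem_filter z hz) i).2]⟩)
      (fun z hz w hw hne => hsep z (Finset.mem_of_mem_filter z hz) w (Finset.mem_of_mem_filter w hw) hne)
  have h1 : (R.card : ℝ) ≤ ((Finset.univ.biUnion (fun i : Fin 3 => F.filter fun x => c i + (ℓ - 1) ≤ x i)).card : ℝ) := by
    exact_mod_cast Finset.card_le_card hsub
  have h2 : ((Finset.univ.biUnion (fun i : Fin 3 => F.filter fun x => c i + (ℓ - 1) ≤ x i)).card : ℝ)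
      ≤ ∑ i : Fin 3, ((F.filter fun x => c i + (ℓ - 1) ≤ x i).card : ℝ) := by
    exact_mod_cast Finset.card_biUnion_le
  have h3 : ∑ i : Fin 3, ((F.filter fun x => c i + (ℓ - 1) ≤ x i).card : ℝ) ≤ ∑ _i : Fin 3, (2 * 1 / δ + 1) * (2 * ℓ / δ + 1) ^ 2 :=
    Finset.sum_le_sum fun i _ => hslab i
  have h4 : ∑ _i : Fin 3, (2 * 1 / δ + 1) * (2 * ℓ / δ + 1) ^ 2 = 3 * ((2 * 1 / δ + 1) * (2 * ℓ / δ + 1) ^ 2) := by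
    rw [Finset.sum_const, Finset.card_univ, Fintype.card_fin, nsmul_eq_mul]; norm_num
  linarith

end Summit.AtomisticToContinuum.Crystallization.Theorems.OverbindingBudgetPeriodicWrap
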